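import Summits.BirchSwinnertonDyer.BirchSwinnertonDyer.Theorems.ManinLocalTwoThreeShiftSpanColumnsEdges
import Literature.NumberTheory.EllipticCurves.ModularCurveIharaLemma
import HarnessLib

/-!
# Route `ManinLocalTwoThree`, crux C3 `ManinPrimeToThreeAtNine` (stmt-BirchSwinnertonDyer-22968), line `kato-shift-three`
# (es g6): the shift span IS the period lattice of the OLDFORM `h = f∣ι₃ − f∣ι₁ = 3f(3τ) − f(τ)` on `Γ₀(3N)`
# (up to index `2`); hence E-es-19 is a statement about the degeneracy maps `X₀(3N) ⇉ X₀(N)` on integral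
# homology — an Ihara-type statement at the prime `3 ∣ N` (line prover p3; helper, unconditional)

For `f ∈ S₂(Γ₀(N))` put `h := degeneracyMap0 N (3N) 3 2 f − degeneracyMap0 N (3N) 1 2 f ∈ S₂(Γ₀(3N))` (the tree's
degeneracy maps, `coe_degeneracyMap0`: `f ↦ f ∣₂ diag(3,1) = 3f(3τ)` and `f ↦ f`).  Then
* `modularSymbol_shiftOldform` — `{∞, r}_h = {∞, 3r}_f − {∞, r}_f` (`modularSymbol_slash_tpD`);
* `cuspSymbol_shiftOldform` — `{∞, γ∞}_h = {∞, 3b/d}_f − {∞, b/d}_f` for `γ = (· b; · d) ∈ Γ₀(3N)`: the periods of `h`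
  ARE the column differences of `…ShiftSpanColumns`;
* `periodLattice_shiftOldform_eq_closure_columns` — `Λ_h` = the span of ALL column differences `{∞, 3b/d}_f − {∞, b/d}_f`,
  `d ≠ 0`, `gcd(d, Nb) = 1` (`3 ∣ N`);
* `two_mul_periodLattice_shiftOldform_le_shiftSpan`, `shiftSpan_le_periodLattice_shiftOldform` — for `9 ∣ N` and any
  signs `ε`: `2Λ_h ⊆ ⟨shift classes over admissible ℓ ≥ ℓ₀⟩ ⊆ Λ_h` (the admissible residue classes of `d` cost at most
  index `2`: `2·{∞,γ∞}_h = {∞,(γ₀γγ)∞}_h − {∞,γ₀∞}_h` with `γ₀γγ`, `γ₀` admissible, `γ ↦ {∞, γ∞}_h` a homomorphism);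
* `shiftClassGenerationThree_iff_oldformLattice` — **E-es-19 ⟺ for every (W-newform) `f` with `9 ∣ N` and `W[3]`
  irreducible, some `m` with `3 ∤ m` has `m·Λ_f ⊆ Λ_h`**: the Legendre signs, the primes and `ℓ₀` are gone; what is
  left is the comparison of `H₁(X₀(N), ℤ)`-periods of `f` with the `H₁(X₀(3N), ℤ)`-periods of `f∣(ι₃ − ι₁)`, i.e. the
  image of `β_* − α_*` on integral homology at a prime DIVIDING the level (cf. `ribet1984_iharaLemma`, which is the
  case `p ∤ M`).
Nothing about BSD, Manin's conjecture or E-es-19 itself is proved here.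
-/

set_option autoImplicit false
set_option linter.dupNamespace false

noncomputable section

open scoped Classical MatrixGroups ModularForm BigOperators

open CongruenceSubgroup Matrix.SpecialLinearGroup ModularGroup
  Literature.NumberTheory.EllipticCurves Literature.NumberTheory.EllipticCurves.ModularForms
  Summit.BirchSwinnertonDyer.Rank1Residual.ManinAdditive

namespace Summit.BirchSwinnertonDyer.BirchSwinnertonDyer.Theorems.ManinLocalTwoThree

section Oldform

variable {N : ℕ} [NeZero N] (f : CuspForm (Gamma0 N) 2)

/-- **`{∞, r}_h = {∞, 3r}_f − {∞, r}_f`** for the oldform `h = f∣ι₃ − f∣ι₁` on `Γ₀(3N)` (`f∣ι₃ = f ∣₂ diag(3,1) = 3f(3τ)`,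
substitution `s = 3t`: `modularSymbol_slash_tpD`; `f∣ι₁ = f`: `coe_degeneracyMap0_one`). [cite: CremonaAlgorithms1997, §2.4] -/
theorem modularSymbol_shiftOldform (r : ℚ) :
    modularSymbol (degeneracyMap0 N (3 * N) 3 2 f - degeneracyMap0 N (3 * N) 1 2 f) r =
      modularSymbol f (3 * r) - modularSymbol f r := by
  have h3 : modularSymbol (degeneracyMap0 N (3 * N) 3 2 f) r = modularSymbol f (3 * r) := by
    rw [modularSymbol, coe_degeneracyMap0 N (3 * N) 3 2 (by rw [mul_comm]) f]
    exact_mod_cast modularSymbol_slash_tpD 3 f r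
  have h1 : modularSymbol (degeneracyMap0 N (3 * N) 1 2 f) r = modularSymbol f r := by
    rw [modularSymbol, coe_degeneracyMap0_one N (3 * N) 2 (dvd_mul_left N 3) f, modularSymbol]
  rw [sub_eq_add_neg, ← neg_one_smul ℂ (degeneracyMap0 N (3 * N) 1 2 f), modularSymbol_add,
    modularSymbol_const_smul, h3, h1]
  ring

/-- **The periods of `h = f∣ι₃ − f∣ι₁` are the column differences**: for `γ = (· b; · d) ∈ Γ₀(3N)` (so `d ≠ 0`),
`{∞, γ∞}_h = {∞, 3b/d}_f − {∞, b/d}_f`. [folklore] -/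
theorem cuspSymbol_shiftOldform (γ : Gamma0 (3 * N)) (hd : ((γ : SL(2, ℤ)) 1 1 : ℤ) ≠ 0) :
    cuspSymbol (degeneracyMap0 N (3 * N) 3 2 f - degeneracyMap0 N (3 * N) 1 2 f) γ =
      modularSymbol f (((3 * (γ : SL(2, ℤ)) 0 1 : ℤ) : ℚ) / (((γ : SL(2, ℤ)) 1 1 : ℤ) : ℚ)) -
        modularSymbol f ((((γ : SL(2, ℤ)) 0 1 : ℤ) : ℚ) / (((γ : SL(2, ℤ)) 1 1 : ℤ) : ℚ)) := by
  rw [cuspSymbol_eq_modularSymbol_div_sub _ γ hd, modularSymbol_shiftOldform, modularSymbol_shiftOldform]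
  push_cast
  ring_nf

/-- `d ≠ 0` for `(· ·; · d) ∈ Γ₀(M)` with `M > 1`. [folklore] -/
theorem apply_one_one_ne_zero_of_one_lt {M : ℕ} (hM : 1 < M) (γ : Gamma0 M) :
    ((γ : SL(2, ℤ)) 1 1 : ℤ) ≠ 0 := by
  intro h0
  have hdet := Matrix.SpecialLinearGroup.det_coe (γ : SL(2, ℤ))
  rw [Matrix.det_fin_two, h0, mul_zero, zero_sub] at hdet
  obtain ⟨c', hc'⟩ : (M : ℤ) ∣ (γ : SL(2, ℤ)) 1 0 :=
    (ZMod.intCast_zmod_eq_zero_iff_dvd _ M).mp (Gamma0_mem.mp γ.2)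
  rw [hc'] at hdet
  have hu : IsUnit (M : ℤ) :=
    isUnit_iff_exists_inv.mpr ⟨-((γ : SL(2, ℤ)) 0 1 * c'), by linear_combination hdet⟩
  rcases Int.isUnit_iff.mp hu with h | h
  · exact hM.ne' (by exact_mod_cast h)
  · have : (0 : ℤ) ≤ (M : ℤ) := by positivity
    omega

/-- **`Λ_h` is the span of all column differences** (`3 ∣ N`): the period lattice of `h = f∣ι₃ − f∣ι₁` on `Γ₀(3N)` is
the subgroup of `ℂ` generated by `{∞, 3b/d}_f − {∞, b/d}_f` over `b d : ℤ`, `d ≠ 0`, `gcd(d, Nb) = 1` (these are exactly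
the second columns of `Γ₀(3N)`). [folklore] -/
theorem periodLattice_shiftOldform_eq_closure_columns (h3 : 3 ∣ N) :
    periodLattice (degeneracyMap0 N (3 * N) 3 2 f - degeneracyMap0 N (3 * N) 1 2 f) =
      AddSubgroup.closure {z : ℂ | ∃ b d : ℤ, d ≠ 0 ∧ IsCoprime d (N * b) ∧
        z = modularSymbol f (((3 * b : ℤ) : ℚ) / d) - modularSymbol f ((b : ℚ) / d)} := by
  have hN0 : 0 < N := Nat.pos_of_ne_zero (NeZero.ne N)
  have h3N : 1 < 3 * N := by omega
  apply le_antisymm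
  · rw [periodLattice, AddSubgroup.closure_le]
    rintro _ ⟨γ, rfl⟩
    have hd := apply_one_one_ne_zero_of_one_lt h3N γ
    apply AddSubgroup.subset_closure
    refine ⟨((γ : SL(2, ℤ)) 0 1 : ℤ), ((γ : SL(2, ℤ)) 1 1 : ℤ), hd, ?_, ?_⟩
    · have hN' : IsCoprime ((γ : SL(2, ℤ)) 1 1 : ℤ) ((3 * N : ℕ) : ℤ) := isCoprime_apply_one_one_level γ
      push_cast at hN'
      exact (hN'.of_mul_right_right).mul_right (isCoprime_apply_zero_one_apply_one_one γ).symm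
    · rw [cuspSymbol_shiftOldform f γ hd]
  · rw [AddSubgroup.closure_le]
    rintro z ⟨b, d, hd0, hcop, rfl⟩
    -- complete `(b, d)` to a matrix of `Γ₀(3N)`
    have hcop' : IsCoprime d (b * ((3 * N : ℕ) : ℤ)) := by
      have hN : IsCoprime d (N : ℤ) := hcop.of_mul_right_left
      have h3' : IsCoprime d (3 : ℤ) := hN.of_isCoprime_of_dvd_right (by exact_mod_cast h3)
      push_cast
      exact hcop.of_mul_right_right.mul_right (h3'.mul_right hN)
    obtain ⟨γ, h01, h11⟩ := exists_gamma0_entry (N := 3 * N) hcop'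
    have hz : cuspSymbol (degeneracyMap0 N (3 * N) 3 2 f - degeneracyMap0 N (3 * N) 1 2 f) γ =
        modularSymbol f (((3 * b : ℤ) : ℚ) / d) - modularSymbol f ((b : ℚ) / d) := by
      rw [cuspSymbol_shiftOldform f γ (by rw [h11]; exact hd0), h01, h11]
    rw [SetLike.mem_coe, ← hz]
    exact cuspSymbol_mem_periodLattice _ γ

/-- **The admissible shift span lies in `Λ_h`.** [folklore] -/
theorem shiftSpan_le_periodLattice_shiftOldform (ε : ℕ → ℤ) (hε : ∀ q, ε q = 1 ∨ ε q = -1) (h9 : 9 ∣ N)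
    (ℓ₀ : ℕ) :
    AddSubgroup.closure
      {z : ℂ | ∃ ℓ ∈ {ℓ : ℕ | ℓ₀ ≤ ℓ ∧ (ℓ.Prime ∧ ¬ ℓ ∣ N ∧ ℓ % 12 = 11 ∧
          ∀ q ∈ N.primeFactors, ¬ q ^ 2 ∣ N → jacobiSym (q : ℤ) ℓ = ε q)},
        ∃ a : ℕ, 0 < a ∧ a < ℓ ∧ z = (modularSymbol f (((3 * a : ℕ) : ℚ) / ℓ) - modularSymbol f 0) -
          (modularSymbol f ((a : ℚ) / ℓ) - modularSymbol f 0)} ≤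
    periodLattice (degeneracyMap0 N (3 * N) 3 2 f - degeneracyMap0 N (3 * N) 1 2 f) := by
  rw [shiftSpan_admissible_eq_closure_columns f ε hε h9 ℓ₀,
    periodLattice_shiftOldform_eq_closure_columns f (dvd_trans (by norm_num) h9)]
  refine AddSubgroup.closure_mono ?_
  rintro z ⟨b, d, hd0, hcop, -, -, -, rfl⟩
  exact ⟨b, d, hd0, hcop, rfl⟩

/-- **`2Λ_h` lies in the admissible shift span.** For `9 ∣ N` and any signs `ε_q = ±1`: `γ ↦ {∞, γ∞}_h` is a
homomorphism on `Γ₀(3N)` and admissibility of the `d`-entry is a quadratic condition, so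
`2·{∞, γ∞}_h = {∞, (γ₀γγ)∞}_h − {∞, γ₀∞}_h` with both `γ₀γγ` and `γ₀` admissible (`exists_gamma0_admissibleThree`).
[folklore] -/
theorem two_mul_periodLattice_shiftOldform_le_shiftSpan (ε : ℕ → ℤ) (hε : ∀ q, ε q = 1 ∨ ε q = -1)
    (h9 : 9 ∣ N) (ℓ₀ : ℕ) {z : ℂ}
    (hz : z ∈ periodLattice (degeneracyMap0 N (3 * N) 3 2 f - degeneracyMap0 N (3 * N) 1 2 f)) :
    2 * z ∈ AddSubgroup.closure
      {z : ℂ | ∃ ℓ ∈ {ℓ : ℕ | ℓ₀ ≤ ℓ ∧ (ℓ.Prime ∧ ¬ ℓ ∣ N ∧ ℓ % 12 = 11 ∧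
          ∀ q ∈ N.primeFactors, ¬ q ^ 2 ∣ N → jacobiSym (q : ℤ) ℓ = ε q)},
        ∃ a : ℕ, 0 < a ∧ a < ℓ ∧ z = (modularSymbol f (((3 * a : ℕ) : ℚ) / ℓ) - modularSymbol f 0) -
          (modularSymbol f ((a : ℚ) / ℓ) - modularSymbol f 0)} := by
  have hN0 : 0 < N := Nat.pos_of_ne_zero (NeZero.ne N)
  have h3 : 3 ∣ N := dvd_trans (by norm_num) h9
  have h3N : 1 < 3 * N := by omega
  set h := degeneracyMap0 N (3 * N) 3 2 f - degeneracyMap0 N (3 * N) 1 2 f with hh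
  rw [shiftSpan_admissible_eq_closure_columns f ε hε h9 ℓ₀]
  set K : AddSubgroup ℂ := AddSubgroup.closure
      {z : ℂ | ∃ b d : ℤ, d ≠ 0 ∧ IsCoprime d (N * b) ∧ d % 3 = 2 ∧ (4 ∣ N → d % 4 = 3) ∧
          (∀ q ∈ N.primeFactors, q ≠ 2 → ¬ q ^ 2 ∣ N →
            jacobiSym d q = if q % 4 = 1 then ε q else -ε q) ∧
          z = modularSymbol f (((3 * b : ℤ) : ℚ) / d) - modularSymbol f ((b : ℚ) / d)} with hK
  have two_not_unit : ¬ IsUnit (2 : ℤ) := by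
    intro h; rcases Int.isUnit_iff.mp h with h | h <;> norm_num at h
  have three_not_unit : ¬ IsUnit (3 : ℤ) := by
    intro h; rcases Int.isUnit_iff.mp h with h | h <;> norm_num at h
  -- an admissible `γ₀ ∈ Γ₀(3N)` (second column `(1, d₀)`)
  obtain ⟨γN, h0₃, h0₄, h0q⟩ := exists_gamma0_admissibleThree (N := N) ε hε h9
  set d₀ : ℤ := ((γN : SL(2, ℤ)) 1 1 : ℤ) with hd₀
  have hd₀N : IsCoprime d₀ (N : ℤ) := isCoprime_apply_one_one_level γN
  have hd₀3N : IsCoprime d₀ (1 * ((3 * N : ℕ) : ℤ)) := by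
    rw [one_mul]
    push_cast
    exact (hd₀N.of_isCoprime_of_dvd_right (by exact_mod_cast h3)).mul_right hd₀N
  obtain ⟨γ₀, -, hγ₀⟩ := exists_gamma0_entry (N := 3 * N) hd₀3N
  -- an admissible matrix of `Γ₀(3N)` has its `h`-period in `K`
  have hadm : ∀ δ : Gamma0 (3 * N), ((δ : SL(2, ℤ)) 1 1 : ℤ) % 3 = 2 →
      (4 ∣ N → ((δ : SL(2, ℤ)) 1 1 : ℤ) % 4 = 3) →
      (∀ q ∈ N.primeFactors, q ≠ 2 → ¬ q ^ 2 ∣ N →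
        jacobiSym ((δ : SL(2, ℤ)) 1 1 : ℤ) q = if q % 4 = 1 then ε q else -ε q) →
      cuspSymbol h δ ∈ K := by
    intro δ h₁ h₂ h₃
    have hd := apply_one_one_ne_zero_of_one_lt h3N δ
    apply AddSubgroup.subset_closure
    refine ⟨((δ : SL(2, ℤ)) 0 1 : ℤ), ((δ : SL(2, ℤ)) 1 1 : ℤ), hd, ?_, h₁, h₂, h₃, ?_⟩
    · have hN' : IsCoprime ((δ : SL(2, ℤ)) 1 1 : ℤ) ((3 * N : ℕ) : ℤ) := isCoprime_apply_one_one_level δ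
      push_cast at hN'
      exact (hN'.of_mul_right_right).mul_right (isCoprime_apply_zero_one_apply_one_one δ).symm
    · rw [hh, cuspSymbol_shiftOldform f δ hd]
  -- reduce to the generators `{∞, γ∞}_h`
  suffices hle : periodLattice h ≤ K.comap (AddMonoidHom.mulLeft (2 : ℂ)) by
    have := hle hz
    rw [AddSubgroup.mem_comap, AddMonoidHom.coe_mulLeft] at this
    exact this
  rw [periodLattice, AddSubgroup.closure_le]
  rintro _ ⟨γ, rfl⟩
  rw [SetLike.mem_coe, AddSubgroup.mem_comap, AddMonoidHom.coe_mulLeft]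
  have hmul : 2 * cuspSymbol h γ = cuspSymbol h (γ₀ * γ * γ) - cuspSymbol h γ₀ := by
    rw [cuspSymbol_mul_holds h (γ₀ * γ) γ, cuspSymbol_mul_holds h γ₀ γ]
    ring
  rw [hmul]
  have h0₃' : (((γ₀ : SL(2, ℤ)) 1 1 : ℤ)) % 3 = 2 := by rw [hγ₀]; exact h0₃
  have h0₄' : 4 ∣ N → (((γ₀ : SL(2, ℤ)) 1 1 : ℤ)) % 4 = 3 := by rw [hγ₀]; exact h0₄
  have h0q' : ∀ q ∈ N.primeFactors, q ≠ 2 → ¬ q ^ 2 ∣ N →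
      jacobiSym ((γ₀ : SL(2, ℤ)) 1 1 : ℤ) q = if q % 4 = 1 then ε q else -ε q := by
    rw [hγ₀]; exact h0q
  refine K.sub_mem (hadm _ ?_ ?_ ?_) (hadm γ₀ h0₃' h0₄' h0q')
  all_goals
    set d : ℤ := (γ : SL(2, ℤ)) 1 1 with hd
    have hD : (((γ₀ * γ * γ : Gamma0 (3 * N)) : SL(2, ℤ)) 1 1 : ℤ) ≡ d₀ * (d * d) [ZMOD N] := by
      have h1 := gamma0_mul_apply_one_one_modEq (γ₀ * γ) γ
      have h2 := gamma0_mul_apply_one_one_modEq γ₀ γ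
      have h3' := h2.mul_right d
      rw [← hd, hγ₀] at *
      have hmod : (((γ₀ * γ * γ : Gamma0 (3 * N)) : SL(2, ℤ)) 1 1 : ℤ) ≡ d₀ * (d * d) [ZMOD ((3 * N : ℕ) : ℤ)] :=
        h1.trans (by simpa [mul_assoc] using h3')
      exact hmod.of_dvd (by push_cast; exact dvd_mul_left _ _)
    have hcopN : IsCoprime d (N : ℤ) := by
      have := isCoprime_apply_one_one_level (N := 3 * N) γ
      push_cast at this
      exact this.of_mul_right_right
  · have hm := hD.of_dvd (by exact_mod_cast h3 : (3 : ℤ) ∣ (N : ℤ))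
    have hd3 : d % 3 ≠ 0 := by
      intro h0
      exact three_not_unit (hcopN.isUnit_of_dvd' (Int.dvd_of_emod_eq_zero h0) (by exact_mod_cast h3))
    have : (((γ₀ * γ * γ : Gamma0 (3 * N)) : SL(2, ℤ)) 1 1 : ℤ) % 3 = d₀ * (d * d) % 3 := hm
    rw [this, Int.mul_emod, mul_self_emod_three hd3, h0₃]
    norm_num
  · intro h4
    have hm := hD.of_dvd (by exact_mod_cast h4 : (4 : ℤ) ∣ (N : ℤ))
    have hd2 : d % 2 = 1 := by
      by_contra h0
      have h2d : (2 : ℤ) ∣ d := by omega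
      have h2N : (2 : ℤ) ∣ (N : ℤ) := dvd_trans (by norm_num) (by exact_mod_cast h4 : (4 : ℤ) ∣ (N : ℤ))
      exact two_not_unit (hcopN.isUnit_of_dvd' h2d h2N)
    have : (((γ₀ * γ * γ : Gamma0 (3 * N)) : SL(2, ℤ)) 1 1 : ℤ) % 4 = d₀ * (d * d) % 4 := hm
    rw [this, Int.mul_emod, mul_self_emod_four hd2, h0₄ h4]
    norm_num
  · intro q hq hq2 hq2N
    have hqN : q ∣ N := Nat.dvd_of_mem_primeFactors hq
    have hm := hD.of_dvd (Int.natCast_dvd_natCast.mpr hqN)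
    rw [jacobiSym.mod_left' hm, jacobiSym.mul_left, jacobiSym.mul_left, h0q q hq hq2 hq2N]
    have hcopq : IsCoprime d (q : ℤ) := hcopN.of_isCoprime_of_dvd_right (Int.natCast_dvd_natCast.mpr hqN)
    have hgcd : d.gcd q = 1 := Int.isCoprime_iff_gcd_eq_one.mp hcopq
    rcases jacobiSym.eq_one_or_neg_one hgcd with h1 | h1 <;> rw [h1] <;> ring

/-- **E-es-19 ⟺ a prime-to-3 multiple of `Λ_f` lies in `Λ_h`**, `h = f∣ι₃ − f∣ι₁ = 3f(3τ) − f(τ)` on `Γ₀(3N)`.  The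
generation law `ShiftClassGenerationThree` holds iff for every `W`-newform `f` of level `N` with `9 ∣ N` and `W[3]`
irreducible some `m` with `3 ∤ m` satisfies `m·Λ_f ⊆ Λ_h` (`⟹`: the admissible shift span lies in `Λ_h`; `⟸`: `2Λ_h`
lies in the admissible shift span, and `3 ∤ 2m`). The Legendre admissibility, the auxiliary primes and `ℓ₀` have
disappeared; nothing is asserted about E-es-19 itself. [folklore] -/
theorem shiftClassGenerationThree_iff_oldformLattice :
    ShiftClassGenerationThree ↔
      ∀ (W : WeierstrassCurve ℚ) [W.IsElliptic] {N : ℕ} [NeZero N] (f : CuspForm (Gamma0 N) 2),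
        IsNewformOf W f → 3 ^ 2 ∣ N → W.HasIrreducibleModPGaloisRep 3 →
        ∃ m : ℕ, ¬ 3 ∣ m ∧ ∀ z ∈ periodLattice f,
          (m : ℂ) * z ∈ periodLattice (degeneracyMap0 N (3 * N) 3 2 f - degeneracyMap0 N (3 * N) 1 2 f) := by
  rw [shiftClassGenerationThree_iff_zero]
  constructor
  · intro H W _ N _ f hf h9 hirr
    obtain ⟨m, hm, hgen⟩ := H W f hf h9 hirr
    have h9' : 9 ∣ N := by norm_num at h9; exact h9
    refine ⟨m, hm, fun z hz => ?_⟩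
    have h := hgen z hz
    have hle := shiftSpan_le_periodLattice_shiftOldform f (epsSign W) (epsSign_eq_one_or W) h9' 0
    simp only [shiftClassSpan, shiftClass, primeClass, AdmissiblePrime, epsSign] at h hle
    exact hle h
  · intro H W _ N _ f hf h9 hirr
    obtain ⟨m, hm, hgen⟩ := H W f hf h9 hirr
    have h9' : 9 ∣ N := by norm_num at h9; exact h9
    refine ⟨2 * m, by omega, fun z hz => ?_⟩
    have h2 := two_mul_periodLattice_shiftOldform_le_shiftSpan f (epsSign W) (epsSign_eq_one_or W) h9' 0
      (hgen z hz)
    have hmul : ((2 * m : ℕ) : ℂ) * z = 2 * ((m : ℂ) * z) := by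
      push_cast
      ring
    rw [hmul]
    simp only [shiftClassSpan, shiftClass, primeClass, AdmissiblePrime, epsSign]
    exact h2

end Oldform

end Summit.BirchSwinnertonDyer.BirchSwinnertonDyer.Theorems.ManinLocalTwoThree

end
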